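import Summits.QuantumFields.YangMills.Theorems.UnitScaleTiltProp7NormHoneFamilyPackage
import Summits.QuantumFields.YangMills.Theorems.UnitScaleTiltProp7QkSupRowOfRegPr
import HarnessLib

/-!
# Route `UnitScaleTilt`, crux K1 «MinimiserStabilityRegPr» (stmt-QuantumFields-19200), EX row (5) `norm_G` (S47 ✓p766895 ∕ S48 ✓p778740) — NORM-G-PKG (O5): **THE S47 ROW `norm_G` FOR
# ALL MEMBERS AS ONE `∃`-PACKAGE, MODULO px19's `hqG` AND ONE `h3`-FAMILY LETTER (STOREY H)** — this lineage's 𝔊-door ✓`Prop7GreenOneGradientRowOfLetters.norm_frakGfR_le_of_letters`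
# (✓p774384 §3: `norm_G ⟸ norm_H₁ ∧ (V1)(Div1)(c1)(c2)(c3)(tJ)(tJd)(Qrow)(∇0)(H∇) ∧ h3`) AT EVERY MEMBER `i : Idx L` of the printed J-slot `Δ₁ᴾ(T_Jᴾ)`, every letter but `h3` FED BY
# ITS LANDED FAMILY: `norm_H₁` ⟸ NORM-H₁-PKG ✓∕⧗`Prop7NormHoneFamilyPackage.normHone_family_exists` (row (6), mod `hqG`); `PosOnto(η)` ⟸ ✓`hco_DeltaEtaSlot_exists` ∘ ✓`posOnto_of_coercive`;
# `PosOnto(Δ₁ᴾ(T_Jᴾ))` ⟸ px12 ✓`hco_DeltaOnePJ_exists`; (V1)(Div1) ⟸ O-G1 ✓`valueDiv_rows_GTone_of_letters` over FILE C ✓`valueDiv_GT_DeltaEtaSlot_sup_family_allMembers`; (c1)(c3) ⟸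
# ✓`hc1_hc3_sup_family`; (c2) ⟸ ✓`hc2_sup_family_allMembers`; (tJ) ⟸ px12 ✓`tjValueRows_exists`; (tJd) ⟸ px12 ✓`tjDivRows_family_of_h133_hqG` ∘ ✓`h133_family_exists` (⇒ `hqG` displayed);
# (Qrow) ⟸ this lineage's ✓`Prop7QkSupRowOfRegPr.supRow_Qk_of_regPr` (`BQ := 30`); (∇0) ⟸ px21 ✓`gradient_GT_DeltaEtaSlot_family_allMembers`; (H∇) ⟸ ✓`hessRow_chain_family_allMembers`; window ⟸
# ✓`hwinJ_of_cap`.  The ONE new display is `h3` — the 𝔊-door's third-word gradient letter (STOREY H) as a per-member FAMILY letter under `RegPr → cap → Lift → a-window` with an L-only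
# constant `M₃ L`; its supplier-to-be is H8-R′ (v2) ∘ {H8-R, BRIDGE v2, H1} knit over the value-letter families, modulo pipeline (ii)'s windowed Hölder letter — a later
# `h3_family_exists`, deliberately NOT this file.  (★★OWNER g36 ■ FINAL NOTICE (1) pens; width seat `ym3-torus-px17` g13, CLAIM 16:54:02Z.)

Cell `ym3-torus` (HUMAN RULING D-0037; rung R3 = SU(2) YM₃ on T³ — NOT d = 4, NOT infinite volume, NOT a mass gap, NOT Clay).  THEOREMS ONLY (0 `def`, 0 `sorry`; ONE decl-local
`maxHeartbeats 400000`, disclosed); `--supports stmt-QuantumFields-19200 --as helper`; count-neutral.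

WHAT IS PROVED (ns `Summit.QuantumFields.YangMills.Theorems.Prop7NormGFamilyPackage`).  For positive L-only weights `c₀ cB : ℕ → ℝ`, a coupling window `0 < a₀ ≤ a₁`, px19's `hqG` letter
(`αq qG hαq hqG hqGrow`, T1's binder VERBATIM) and the `h3`-family letter (`αh M₃ hαh h3row` — no sign letter on `M₃` is needed):
* ★★★ `normG_family_exists` — `∃ αN B₀ : ℕ → ℝ` (cap with the three windows of record, `αN ≤ αq`, `αN ≤ αh`, `αN ≤ 1`, `0 ≤ B₀`) such that for every `L > 1`, `i : Idx L`, `U₀` with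
  `RegPr ρ U₀`, `ρ ≤ αN L`, under `Lift`, ROOM (displayed while T3∕K6-Δ₁∕K6-H1∕T1∘K6-h133 carry it; R-edition by `gen_oR`), every coupling in the window: **S47's `norm_G` ROW TEXT**
  `∀ f, ‖frakGfR … a (DeltaOnePJ … a) U₀ f‖ ≤ B₀ L * ‖f‖` (S47 :168–181 modulo `a L i ↦ a`; `DeltaOnePJ_def` is `rfl`, used once inside).
HYP-SAT (★★OWNER RULING №42).  Displayed: `RegPr`∕cap∕`Lift`∕ROOM∕coupling window (classes of record), `hqG` (as rows (6)'s packages) and `h3row` — print's Thm 3.1 (3.42)–(3.44) ∕ Thm 3.13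
gradient-row class for the third 𝔊-word, a real inequality between displayed terms reading `0 ≤ 0` at `A = 0`, NOT a gauge letter, NOT a restatement of the row (the row is the sup norm of
`𝔊 = PᴾG₁ − H₁Q_kG₁` on `NegSize` data; `h3` is one (115)-gradient row of one word of `G₁`'s six-term expansion); constants EXISTENTIAL-but-L-only; conclusion non-vacuous; no `Prop`
placeholder.  HONEST SCOPE.  An `∃`-assembly over landed packages (no estimate proved here); nothing of `hqG`, `h3`, `hThm2S`, EX `stub_existenceMinimalOrbit`, 19200 or the rung is proved;
no summit is proved by a helper; the Yang–Mills mass gap is NOT proved.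

References: T. Bałaban, CMP **99** (1985) 389–434 [Balaban1985BackgroundPropagators] ((3.3) p.391, (3.16) p.393, (3.117)–(3.138) pp.419–423, Thm 3.12 p.423, Thm 3.13 p.426,
(3.152)–(3.153) p.426); CMP **102** (1985) 277–309 [Balaban1985Variational] (Thm 1 p.279, (19) p.281, (103) p.293, (110)–(111) p.294, (115)–(117) pp.294–295).
-/

set_option autoImplicit false

noncomputable section

open scoped Matrix.Norms.L2Operator BigOperators InnerProductSpace ComplexConjugate

namespace Summit.QuantumFields.YangMills.Theorems.Prop7NormGFamilyPackage

open Literature.MathematicalPhysics.QuantumFieldTheory.Balaban1983to89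
open Literature.MathematicalPhysics.QuantumFieldTheory.Balaban1983to89.T3ContinuumYM3Torus
open Literature.MathematicalPhysics.QuantumFieldTheory.Balaban1983to89.T3Thm1Carrier (Idx)
open Literature.MathematicalPhysics.QuantumFieldTheory.Balaban1983to89.T3PrintedRegularMinimiser (RegPr)
open Literature.MathematicalPhysics.QuantumFieldTheory.Balaban1983to89.T3PrintedMinimiserExistence (regPr_mono)
open B15DeterminingSets (embIter)
open T3SectALandauChart (bgUnits)
open B9SectCLatticeCarrier (Bond)
open B9Eq311L2Pairing (WL2)
open B11Eq115Space (NegSize)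
open B11Eq111FrakG (nabla115)
open B11Eq103H1Complex (SiteL2K BondL2K)
open B5Eq118OneStroke (iterBlockOf)
open Summit.QuantumFields.YangMills.Theorems.Prop8Chart (emlIterU)
open Summit.QuantumFields.YangMills.Theorems.Prop7SectET3Transport (periodsT3 bondEquiv bgOfCfg)
open Summit.QuantumFields.YangMills.Theorems.Prop7SectET3HilbertLetters (W₂ toL2 toL2S toL2B DL2 DstarL2)
open Summit.QuantumFields.YangMills.Theorems.Prop7SectET3GaugeProjector (RS)
open Summit.QuantumFields.YangMills.Theorems.Prop7SectET3WilsonHessian (DeltaEtaSlot)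
open Summit.QuantumFields.YangMills.Theorems.Prop7SectET3CurvedPropagators (Qk GT PosOnto H1f frakGfR)
open Summit.QuantumFields.YangMills.Theorems.Prop7SectET3DeltaPiPInv (GprimeP)
open Summit.QuantumFields.YangMills.Theorems.Prop7SectET3DeltaOne (avgHess)
open Summit.QuantumFields.YangMills.Theorems.Prop7SectET3DeltaOnePInv (DeltaOneP TJSlotP DeltaOnePJ DeltaOnePJ_def)
open Summit.QuantumFields.YangMills.Theorems.Prop7CurvedMemberLocalGradient (exists_curved_localGradient)
open Summit.QuantumFields.YangMills.Theorems.Prop7OneFormCoerciveHolds (hco_DeltaEtaSlot_exists posOnto_of_coercive)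
open Summit.QuantumFields.YangMills.Theorems.Prop7OneFormGreenSupRowsAllMembers (valueDiv_GT_DeltaEtaSlot_sup_family_allMembers)
open Summit.QuantumFields.YangMills.Theorems.Prop7ChainPotentialHessianFamily (alphaH_pos hc1_hc3_sup_family)
open Summit.QuantumFields.YangMills.Theorems.Prop7GaugeProjectorC2SupAllMembers (hc2_sup_family_allMembers)
open Summit.QuantumFields.YangMills.Theorems.Prop7ChainPotentialHessianAllMembers (hessRow_chain_family_allMembers)
open Summit.QuantumFields.YangMills.Theorems.Prop7OneFormGreenBlockGradientFamilyAllMembers (gradient_GT_DeltaEtaSlot_family_allMembers)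
open Summit.QuantumFields.YangMills.Theorems.Prop7TJSlotCoerciveClosed (tjValueRows_exists hco_DeltaOnePJ_exists)
open Summit.QuantumFields.YangMills.Theorems.Prop7H133FamilyPackage (h133_family_exists)
open Summit.QuantumFields.YangMills.Theorems.Prop7TJRowsFamilyOfH133 (tjDivRows_family_of_h133_hqG)
open Summit.QuantumFields.YangMills.Theorems.Prop7GreenOneSupRowsOfLetters (valueDiv_rows_GTone_of_letters)
open Summit.QuantumFields.YangMills.Theorems.Prop7GreenOneGradientRowOfLetters (norm_frakGfR_le_of_letters)
open Summit.QuantumFields.YangMills.Theorems.Prop7GreenOneGradientFamily (hwinJ_of_cap)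
open Summit.QuantumFields.YangMills.Theorems.Prop7QkSupRowOfRegPr (supRow_Qk_of_regPr)
open Summit.QuantumFields.YangMills.Theorems.Prop7NormHoneFamilyPackage (normHone_family_exists)

set_option maxHeartbeats 400000 in -- HEARTBEAT BUDGET (README owner rule 2026-08-28): an eleven-family knit, same class as ✓`gradient_GTone_family_exists` (≈ 150k measured there); decl-local, line-neutral.
/-- ★★★ **THE S47 ROW `norm_G` FOR ALL MEMBERS AS ONE `∃`-PACKAGE, MODULO `hqG` AND THE `h3`-FAMILY LETTER (the row (5) socket)** — ✓`norm_frakGfR_le_of_letters` at the printed J-slot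
of every member, `norm_H₁` from ✓`normHone_family_exists`, the word letters from their landed families, (Qrow) from ✓`supRow_Qk_of_regPr`, the `G₁` α-window from ✓`hwinJ_of_cap`; `h3` displayed.
[cite: Balaban1985BackgroundPropagators, (3.117)–(3.138) pp.419–423, Thm 3.12 p.423, Thm 3.13 p.426, (3.152)–(3.153) p.426; Balaban1985Variational, Thm 1 p.279, (115)–(117) pp.294–295] -/
theorem normG_family_exists [hFL : ∀ F : T3Family, Fact (0 < (F.L : ℝ))] [hFη : ∀ (F : T3Family) (k : ℕ), Fact (0 < ((F.L : ℝ)⁻¹) ^ k)]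
    (c₀ cB : ℕ → ℝ) [hc₀ : ∀ L : ℕ, Fact (0 < c₀ L)] [hcB : ∀ L : ℕ, Fact (0 < cB L)] {a₀ a₁ : ℝ} (ha₀ : 0 < a₀) (ha₀₁ : a₀ ≤ a₁)
    (αq qG : ℕ → ℝ) (hαq : ∀ L : ℕ, 1 < L → 0 < αq L) (hqG : ∀ L : ℕ, 1 < L → 0 ≤ qG L)
    (hqGrow : ∀ (L : ℕ), 1 < L → ∀ (i : Idx L) (U₀ : GaugeField (i.1.1.P i.1.2.2) 0 (Matrix.specialUnitaryGroup (Fin 2) ℂ)), RegPr i.1.1 i.1.2.1 i.1.2.2 (αq L) U₀ →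
      ∀ (X' : PBond (i.1.1.P i.1.2.2) 0 → Matrix (Fin 2) (Fin 2) ℂ) (s : ℝ) (x : Site (i.1.1.P i.1.2.2) 0) (A : Matrix (Fin 2) (Fin 2) ℂ), (∀ b, ‖X' b‖ ≤ s) →
        ∑ y : PBond (i.1.1.P i.1.2.1) 0, ‖avgHess i.1.1 i.1.2.1 i.1.2.2 i.2.2.le U₀ X'
            ((toL2 i.1.1 i.1.2.2 (c₀ L)).symm (DL2 i.1.1 i.1.2.1 i.1.2.2 (c₀ L) U₀ (toL2S i.1.1 i.1.2.2 (c₀ L) (Pi.single x A)))) y‖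
          ≤ qG L * ((L : ℝ) ^ (i.1.2.2 - i.1.2.1))⁻¹ * s * ‖A‖)
    (αh M₃ : ℕ → ℝ) (hαh : ∀ L : ℕ, 1 < L → 0 < αh L)
    (h3row : ∀ (L : ℕ), 1 < L → ∀ (i : Idx L) (U₀ : GaugeField (i.1.1.P i.1.2.2) 0 (Matrix.specialUnitaryGroup (Fin 2) ℂ)), ∀ ρ : ℝ, RegPr i.1.1 i.1.2.1 i.1.2.2 ρ U₀ → ρ ≤ αh L →
        (∀ cf : Site (i.1.1.P i.1.2.2) (i.1.2.2 - i.1.2.1) → Matrix (Fin 2) (Fin 2) ℂ,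
        (∀ e' : PBond (i.1.1.P i.1.2.2) (i.1.2.2 - i.1.2.1), cf e'.src = ((emlIterU (i.1.2.2 - i.1.2.1) (bgUnits i.1.1 i.1.2.2 U₀) e' : (Matrix (Fin 2) (Fin 2) ℂ)ˣ) : Matrix (Fin 2) (Fin 2) ℂ) * cf e'.tgt *
        (((emlIterU (i.1.2.2 - i.1.2.1) (bgUnits i.1.1 i.1.2.2 U₀) e')⁻¹ : (Matrix (Fin 2) (Fin 2) ℂ)ˣ) : Matrix (Fin 2) (Fin 2) ℂ)) →
        ∃ l₀ : Site (i.1.1.P i.1.2.2) 0 → Matrix (Fin 2) (Fin 2) ℂ,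
        (∀ b' : PBond (i.1.1.P i.1.2.2) 0, l₀ b'.src = ((bgUnits i.1.1 i.1.2.2 U₀ b' : (Matrix (Fin 2) (Fin 2) ℂ)ˣ) : Matrix (Fin 2) (Fin 2) ℂ) * l₀ b'.tgt * (((bgUnits i.1.1 i.1.2.2 U₀ b')⁻¹ : (Matrix (Fin 2) (Fin 2) ℂ)ˣ) : Matrix (Fin 2) (Fin 2) ℂ)) ∧
        ∀ y : Site (i.1.1.P i.1.2.2) (i.1.2.2 - i.1.2.1), l₀ (embIter (i.1.2.2 - i.1.2.1) y) = cf y) →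
      ∀ a : ℝ, a₀ * (c₀ L / cB L) * ((i.1.1.L : ℝ) ^ (i.1.2.2 - i.1.2.1)) ^ 3 ≤ a → a ≤ a₁ * (c₀ L / cB L) * ((i.1.1.L : ℝ) ^ (i.1.2.2 - i.1.2.1)) ^ 3 →
      ∀ A : PBond (i.1.1.P i.1.2.2) 0 → Matrix (Fin 2) (Fin 2) ℂ,
        ‖nabla115 (((i.1.1.L : ℝ)⁻¹) ^ (i.1.2.2 - i.1.2.1)) (bgOfCfg i.1.1 i.1.2.2 U₀)
            (fun q : Bond 3 (periodsT3 i.1.1 i.1.2.2) => (toL2 i.1.1 i.1.2.2 (c₀ L)).symm (DL2 i.1.1 i.1.2.1 i.1.2.2 (c₀ L) U₀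
              (GprimeP i.1.1 i.1.2.1 i.1.2.2 i.2.2.le (c₀ L) (cB L) a U₀ (RS i.1.1 i.1.2.1 i.1.2.2 i.2.2.le (c₀ L) (cB L) U₀
                (DstarL2 i.1.1 i.1.2.1 i.1.2.2 (c₀ L) U₀ (GT i.1.1 i.1.2.1 i.1.2.2 i.2.2.le (c₀ L) (cB L) a
                  (DeltaOneP i.1.1 i.1.2.1 i.1.2.2 i.2.2.le (c₀ L) (cB L) a (TJSlotP i.1.1 i.1.2.1 i.1.2.2 i.2.2.le (c₀ L) (cB L) a)) U₀ (toL2 i.1.1 i.1.2.2 (c₀ L) A))))))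
              ((bondEquiv i.1.1 i.1.2.2).symm q))‖ ≤ M₃ L * ‖A‖) :
    ∃ (αN B₀ : ℕ → ℝ),
      (∀ L : ℕ, 1 < L → 0 < αN L) ∧ (∀ L : ℕ, 1 < L → 10 ^ 12 * (L : ℝ) ^ 3 * αN L ≤ 1) ∧ (∀ L : ℕ, 1 < L → 10 ^ 10 * (L : ℝ) ^ 6 * αN L ≤ 1) ∧
      (∀ L : ℕ, 1 < L → 13 * 10 ^ 14 * (L : ℝ) ^ 3 * αN L ≤ 1) ∧ (∀ L : ℕ, 1 < L → αN L ≤ αq L) ∧ (∀ L : ℕ, 1 < L → αN L ≤ αh L) ∧ (∀ L : ℕ, 1 < L → αN L ≤ 1) ∧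
      (∀ L : ℕ, 1 < L → 0 ≤ B₀ L) ∧
    ∀ (L : ℕ), 1 < L → ∀ (i : Idx L) (U₀ : GaugeField (i.1.1.P i.1.2.2) 0 (Matrix.specialUnitaryGroup (Fin 2) ℂ)), ∀ ρ : ℝ, RegPr i.1.1 i.1.2.1 i.1.2.2 ρ U₀ → ρ ≤ αN L →
        (∀ cf : Site (i.1.1.P i.1.2.2) (i.1.2.2 - i.1.2.1) → Matrix (Fin 2) (Fin 2) ℂ,
        (∀ e' : PBond (i.1.1.P i.1.2.2) (i.1.2.2 - i.1.2.1), cf e'.src = ((emlIterU (i.1.2.2 - i.1.2.1) (bgUnits i.1.1 i.1.2.2 U₀) e' : (Matrix (Fin 2) (Fin 2) ℂ)ˣ) : Matrix (Fin 2) (Fin 2) ℂ) * cf e'.tgt *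
        (((emlIterU (i.1.2.2 - i.1.2.1) (bgUnits i.1.1 i.1.2.2 U₀) e')⁻¹ : (Matrix (Fin 2) (Fin 2) ℂ)ˣ) : Matrix (Fin 2) (Fin 2) ℂ)) →
        ∃ l₀ : Site (i.1.1.P i.1.2.2) 0 → Matrix (Fin 2) (Fin 2) ℂ,
        (∀ b' : PBond (i.1.1.P i.1.2.2) 0, l₀ b'.src = ((bgUnits i.1.1 i.1.2.2 U₀ b' : (Matrix (Fin 2) (Fin 2) ℂ)ˣ) : Matrix (Fin 2) (Fin 2) ℂ) * l₀ b'.tgt * (((bgUnits i.1.1 i.1.2.2 U₀ b')⁻¹ : (Matrix (Fin 2) (Fin 2) ℂ)ˣ) : Matrix (Fin 2) (Fin 2) ℂ)) ∧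
        ∀ y : Site (i.1.1.P i.1.2.2) (i.1.2.2 - i.1.2.1), l₀ (embIter (i.1.2.2 - i.1.2.1) y) = cf y) →
      2 * (12 * i.1.1.L ^ (i.1.2.2 - i.1.2.1) + 5) ≤ (i.1.1.P i.1.2.2).sitesPerDir 0 →
      ∀ a : ℝ, a₀ * (c₀ L / cB L) * ((i.1.1.L : ℝ) ^ (i.1.2.2 - i.1.2.1)) ^ 3 ≤ a → a ≤ a₁ * (c₀ L / cB L) * ((i.1.1.L : ℝ) ^ (i.1.2.2 - i.1.2.1)) ^ 3 →
      ∀ f, ‖frakGfR i.1.1 i.1.2.1 i.1.2.2 i.2.2.le (c₀ L) (cB L) a (DeltaOnePJ i.1.1 i.1.2.1 i.1.2.2 i.2.2.le (c₀ L) (cB L) a) U₀ f‖ ≤ B₀ L * ‖f‖ := by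
  classical
  -- the landed families
  obtain ⟨αco, γco, hαco, hWco, hwinco, hγco, hco⟩ := hco_DeltaEtaSlot_exists c₀ cB ha₀
  obtain ⟨αcJ, γcJ, hαcJ, hWcJ, hwincJ, hγcJ, hcoJ⟩ := hco_DeltaOnePJ_exists c₀ cB ha₀ ha₀₁
  obtain ⟨αS, BV, BD, hαS, hWS12, hWS10, hWS13, hBV, hBD, hS⟩ := valueDiv_GT_DeltaEtaSlot_sup_family_allMembers c₀ cB ha₀ ha₀₁
  obtain ⟨C₁, C₃, hC₁, hC₃, hc13⟩ := hc1_hc3_sup_family c₀ cB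
  obtain ⟨C₂, hC₂, hc2⟩ := hc2_sup_family_allMembers c₀ cB
  obtain ⟨αH, BH, hαH, hWH, hBH, hHD⟩ := hessRow_chain_family_allMembers c₀ cB
  obtain ⟨αNb, BG, hαNb, hWN12, hWN10, hWN13, hBG, hG0⟩ := gradient_GT_DeltaEtaSlot_family_allMembers c₀ cB ha₀ ha₀₁
  obtain ⟨αT, MT, hαT, hWT12, hWT10, hWT13, hWT16, hαT1, hMT, hT⟩ := tjValueRows_exists c₀ cB ha₀ ha₀₁
  obtain ⟨αK, CH, δH, hαK, hWK12, hWK10, hWK13, hαK1, hCH, hδH, h133⟩ := h133_family_exists c₀ cB ha₀ ha₀₁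
  obtain ⟨αD, MD, hαD, hWD12, hWD10, hWD13, hαDK, hαDq, hαD1, hMD, hD⟩ :=
    tjDivRows_family_of_h133_hqG c₀ cB αK CH δH hαK hWK12 hWK10 hWK13 hCH hδH h133 αq qG hαq hqG hqGrow
  obtain ⟨αQ, BHq, hαQ, hWQ12, hWQ10, hWQ13, hαQq, hαQ1, hBHq, hnormH⟩ := normHone_family_exists c₀ cB ha₀ ha₀₁ αq qG hαq hqG hqGrow
  -- the window modulus and the cap
  set W : ℕ → ℝ := fun L => 4 * C₁ L * (BV L + BD L) + ((12 + MD L) * C₃ L * (1 + C₂ L + 4 * C₁ L * (BV L + BD L)) + MT L * (BV L + BD L)) * (1 + C₂ L) with hWd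
  have hW0 : ∀ L : ℕ, 1 < L → 0 ≤ W L := fun L hL => by
    have := hC₁ L hL; have := hC₂ L hL; have := hC₃ L hL; have := hBV L hL; have := hBD L hL; have := hMT L hL; have := hMD L hL
    simp only [hWd]; positivity
  set αN : ℕ → ℝ := fun L =>
    min (min (min (min (min (αco L) (αcJ L)) (min (αS L) (αNb L))) (min (min (αH L) (min (αT L) (αD L)))
      (min (1 / (10 ^ 12 * (L : ℝ) ^ 3)) (1 / (2 * ((exists_curved_localGradient.choose + 1) * (48 * (6 * Real.sqrt 2 * Real.sqrt 10 + 6 * Real.sqrt 2))))))))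
    (min 1 (1 / (2 * W L + 1)))) (min (αQ L) (αh L)) with hαN
  have hαN0 : ∀ L : ℕ, 1 < L → 0 < αN L := fun L hL => by
    have := hαco L hL; have := hαcJ L hL; have := hαS L hL; have := hαNb L hL; have := hαH L hL; have := hαT L hL; have := hαD L hL
    have := alphaH_pos L hL; have := hW0 L hL; have := hαQ L hL; have := hαh L hL
    simp only [hαN]
    refine lt_min (lt_min (lt_min (lt_min (lt_min ‹_› ‹_›) (lt_min ‹_› ‹_›)) (lt_min (lt_min ‹_› (lt_min ‹_› ‹_›)) ‹_›)) (lt_min one_pos (by positivity))) (lt_min ‹_› ‹_›)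
  have hαco' : ∀ L, αN L ≤ αco L := fun L => by
    simp only [hαN]; exact (min_le_left _ _).trans ((min_le_left _ _).trans ((min_le_left _ _).trans ((min_le_left _ _).trans (min_le_left _ _))))
  have hαcJ' : ∀ L, αN L ≤ αcJ L := fun L => by
    simp only [hαN]; exact (min_le_left _ _).trans ((min_le_left _ _).trans ((min_le_left _ _).trans ((min_le_left _ _).trans (min_le_right _ _))))
  have hαS' : ∀ L, αN L ≤ αS L := fun L => by
    simp only [hαN]; exact (min_le_left _ _).trans ((min_le_left _ _).trans ((min_le_left _ _).trans ((min_le_right _ _).trans (min_le_left _ _))))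
  have hαNb' : ∀ L, αN L ≤ αNb L := fun L => by
    simp only [hαN]; exact (min_le_left _ _).trans ((min_le_left _ _).trans ((min_le_left _ _).trans ((min_le_right _ _).trans (min_le_right _ _))))
  have hαH' : ∀ L, αN L ≤ αH L := fun L => by
    simp only [hαN]; exact (min_le_left _ _).trans ((min_le_left _ _).trans ((min_le_right _ _).trans ((min_le_left _ _).trans (min_le_left _ _))))
  have hαT' : ∀ L, αN L ≤ αT L := fun L => by
    simp only [hαN]; exact (min_le_left _ _).trans ((min_le_left _ _).trans ((min_le_right _ _).trans ((min_le_left _ _).trans ((min_le_right _ _).trans (min_le_left _ _)))))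
  have hαD' : ∀ L, αN L ≤ αD L := fun L => by
    simp only [hαN]; exact (min_le_left _ _).trans ((min_le_left _ _).trans ((min_le_right _ _).trans ((min_le_left _ _).trans ((min_le_right _ _).trans (min_le_right _ _)))))
  have hαX' : ∀ L, αN L ≤ min (1 / (10 ^ 12 * (L : ℝ) ^ 3)) (1 / (2 * ((exists_curved_localGradient.choose + 1) * (48 * (6 * Real.sqrt 2 * Real.sqrt 10 + 6 * Real.sqrt 2))))) := fun L => by
    simp only [hαN]; exact (min_le_left _ _).trans ((min_le_left _ _).trans ((min_le_right _ _).trans (min_le_right _ _)))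
  have hα1 : ∀ L, αN L ≤ 1 := fun L => by simp only [hαN]; exact (min_le_left _ _).trans ((min_le_right _ _).trans (min_le_left _ _))
  have hαW : ∀ L, αN L ≤ 1 / (2 * W L + 1) := fun L => by simp only [hαN]; exact (min_le_left _ _).trans ((min_le_right _ _).trans (min_le_right _ _))
  have hαQ' : ∀ L, αN L ≤ αQ L := fun L => by simp only [hαN]; exact (min_le_right _ _).trans (min_le_left _ _)
  have hαh' : ∀ L, αN L ≤ αh L := fun L => by simp only [hαN]; exact (min_le_right _ _).trans (min_le_right _ _)
  -- the closed constant: ✓`norm_frakGfR_le_of_letters`' `max M_V M_∇` at the member constants (all L-only)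
  refine ⟨αN, fun L =>
    max (2 * (BV L + BD L) + C₂ L * (2 * (BV L + BD L)) + BHq L * 30 * (2 * (BV L + BD L)))
      ((BG L * (1 + 4 * αN L * C₁ L * (2 * (BV L + BD L)) + (4 * αN L * C₁ L * C₃ L * (12 * αN L + αN L * MD L) + αN L * MT L) * (2 * (BV L + BD L) + C₂ L * (2 * (BV L + BD L))))
        + BH L * (12 * αN L + αN L * MD L) * (2 * (BV L + BD L) + C₂ L * (2 * (BV L + BD L)))) + M₃ L + BHq L * 30 * (2 * (BV L + BD L))),
    hαN0, fun L hL => ?_, fun L hL => ?_, fun L hL => ?_, fun L hL => (hαD' L).trans (hαDq L hL), fun L hL => hαh' L, fun L _ => hα1 L, fun L hL => ?_, ?_⟩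
  · exact (mul_le_mul_of_nonneg_left (hαco' L) (by positivity)).trans (hWco L hL)
  · exact (mul_le_mul_of_nonneg_left (hαS' L) (by positivity)).trans (hWS10 L hL)
  · exact (mul_le_mul_of_nonneg_left (hαco' L) (by positivity)).trans (hwinco L hL)
  · have := hBV L hL; have := hBD L hL; have := hC₂ L hL; have := hBHq L hL
    exact le_max_of_le_left (by positivity)
  -- the member
  intro L hL i U₀ ρ hreg hρ hlift hroom a ha₀a ha₁a f
  have hc₀L : 0 < c₀ L := (hc₀ L).out
  have hcBL : 0 < cB L := (hcB L).out
  have hL0 : (0 : ℝ) < L := by exact_mod_cast lt_trans zero_lt_one hL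
  have hLL : (L : ℝ) = (i.1.1.L : ℝ) := by rw [i.2.1]
  have hαL := hαN0 L hL
  have ha : 0 ≤ a := le_trans (by positivity) ha₀a
  have hregN : RegPr i.1.1 i.1.2.1 i.1.2.2 (αN L) U₀ := regPr_mono i.1.1 hρ hreg
  haveI : Fact (0 < (i.1.1.L : ℝ)) := hFL i.1.1
  haveI : Fact (0 < ((i.1.1.L : ℝ)⁻¹) ^ (i.1.2.2 - i.1.2.1)) := hFη i.1.1 _
  -- the windows of record at this member
  have hw13 : 13 * 10 ^ 14 * (i.1.1.L : ℝ) ^ 3 * αN L ≤ 1 := by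
    rw [← hLL]; exact (mul_le_mul_of_nonneg_left (hαco' L) (by positivity)).trans (hwinco L hL)
  have hw10 : 10 ^ 10 * (i.1.1.L : ℝ) ^ 6 * αN L ≤ 1 := by
    rw [← hLL]; exact (mul_le_mul_of_nonneg_left (hαS' L) (by positivity)).trans (hWS10 L hL)
  have hw12 : 10 ^ 12 * (i.1.1.L : ℝ) ^ 3 * αN L ≤ 1 := by
    rw [← hLL]; exact (mul_le_mul_of_nonneg_left (hαco' L) (by positivity)).trans (hWco L hL)
  -- PosOnto at the two slots
  have hp₀ : PosOnto i.1.1 i.1.2.1 i.1.2.2 i.2.2.le (c₀ L) (cB L) a (DeltaEtaSlot i.1.1 i.1.2.1 i.1.2.2 (c₀ L)) U₀ :=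
    posOnto_of_coercive i.2.2.le (cB L) i.2.2 hregN hw13 (hγco L hL) _ (hco L hL i U₀ ρ hreg (hρ.trans (hαco' L)) hlift a ha₀a)
  have hp₁ : PosOnto i.1.1 i.1.2.1 i.1.2.2 i.2.2.le (c₀ L) (cB L) a
      (DeltaOneP i.1.1 i.1.2.1 i.1.2.2 i.2.2.le (c₀ L) (cB L) a (TJSlotP i.1.1 i.1.2.1 i.1.2.2 i.2.2.le (c₀ L) (cB L) a)) U₀ :=
    (hcoJ L hL i U₀ ρ hreg (hρ.trans (hαcJ' L)) hlift hroom a ha₀a ha₁a).2.1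
  -- the letters at this member
  obtain ⟨hV, hDiv⟩ := hS L hL i U₀ ρ hreg (hρ.trans (hαS' L)) hlift a ha₀a ha₁a
  have hc13m := hc13 L hL i U₀ ρ hreg (hρ.trans (hαX' L)) hlift a ha
  have hc1 := fun (w : Site (i.1.1.P i.1.2.2) 0 → Matrix (Fin 2) (Fin 2) ℂ) (m' : ℝ) (hw : ∀ x, ‖w x‖ ≤ m') => (hc13m w m' hw).1
  have hc3 := fun (w : Site (i.1.1.P i.1.2.2) 0 → Matrix (Fin 2) (Fin 2) ℂ) (m' : ℝ) (hw : ∀ x, ‖w x‖ ≤ m') => (hc13m w m' hw).2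
  have hc2m := hc2 L hL i U₀ ρ hreg (hρ.trans (hαX' L)) hlift a ha
  have hHDm := hHD L hL i U₀ ρ hreg (hρ.trans (hαH' L)) hlift a ha
  have hG0m := hG0 L hL i U₀ ρ hreg (hρ.trans (hαNb' L)) hlift a ha₀a ha₁a
  have h3m := h3row L hL i U₀ ρ hreg (hρ.trans (hαh' L)) hlift a ha₀a ha₁a
  have hHm := hnormH L hL i U₀ ρ hreg (hρ.trans (hαQ' L)) hlift hroom a ha₀a ha₁a
  rw [DeltaOnePJ_def] at hHm
  -- (Qrow) from `RegPr` in the (COL) windows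
  have hQ := supRow_Qk_of_regPr i.1.1 (h := i.2.2.le) (c₀ := c₀ L) (cB := cB L) hαL hw10 hw12 U₀ hregN
  -- (tJ): the sup row of `T_Jᴾ` at `ρ' := αN L`
  have hTJ : ∀ (Y : PBond (i.1.1.P i.1.2.2) 0 → Matrix (Fin 2) (Fin 2) ℂ) (s' : ℝ), (∀ b, ‖Y b‖ ≤ s') →
      ∀ b, ‖(toL2 i.1.1 i.1.2.2 (c₀ L)).symm (TJSlotP i.1.1 i.1.2.1 i.1.2.2 i.2.2.le (c₀ L) (cB L) a U₀ (toL2 i.1.1 i.1.2.2 (c₀ L) Y)) b‖ ≤ (αN L * MT L) * s' :=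
    (hT L hL i U₀ ρ hreg (hρ.trans (hαT' L)) hlift hroom a ha₀a ha₁a).1 (αN L) hαL.le (hαT' L) hregN
  -- (tJd): the divergence row of `T_Jᴾ` at `ρ' := αN L`, rate `δ := 0` (modulo `hqG`)
  have hTJd : ∀ (Y : PBond (i.1.1.P i.1.2.2) 0 → Matrix (Fin 2) (Fin 2) ℂ) (s' : ℝ), (∀ b, ‖Y b‖ ≤ s') →
      ∀ x, ‖(toL2S i.1.1 i.1.2.2 (c₀ L)).symm (DstarL2 i.1.1 i.1.2.1 i.1.2.2 (c₀ L) U₀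
        (TJSlotP i.1.1 i.1.2.1 i.1.2.2 i.2.2.le (c₀ L) (cB L) a U₀ (toL2 i.1.1 i.1.2.2 (c₀ L) Y))) x‖ ≤ (αN L * MD L) * s' := by
    intro Y s' hY x
    have hs' : 0 ≤ s' := (norm_nonneg _).trans (hY ⟨Classical.arbitrary _, 0⟩)
    have hrow := (hD L hL i U₀ ρ hreg (hρ.trans (hαD' L)) hlift hroom a ha₀a ha₁a).1 (αN L) hαL (hαD' L) hregN 0 le_rfl
      (Classical.arbitrary _) Y s' hs' (fun b => by rw [zero_mul, neg_zero, Real.exp_zero, mul_one]; exact hY b) x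
    simpa only [zero_mul, neg_zero, Real.exp_zero, mul_one] using hrow
  -- the `G₁` window
  have hwin : 4 * αN L * C₁ L * (BV L + BD L) + ((12 * αN L + αN L * MD L) * C₃ L * (1 + C₂ L + 4 * αN L * C₁ L * (BV L + BD L)) + (αN L * MT L) * (BV L + BD L)) * (1 + C₂ L)
      ≤ 1 / 2 := by
    refine hwinJ_of_cap hαL.le (hα1 L) (hC₁ L hL) (hC₂ L hL) (hC₃ L hL) (add_nonneg (hBV L hL) (hBD L hL)) (hMT L hL) (hMD L hL) ?_
    have hWL := hW0 L hL
    have h1 := hαW L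
    rw [le_div_iff₀ (by positivity)] at h1
    simpa only [hWd] using h1
  -- (V1)(Div1) at the J-slot, `(A, ‖A‖)` currency
  have hMTL := hMT L hL; have hMDL := hMD L hL; have hBVL := hBV L hL; have hBDL := hBD L hL; have hαNle := hαL.le
  have hCT0 : 0 ≤ αN L * MT L := mul_nonneg hαNle hMTL
  have hCTD0 : 0 ≤ αN L * MD L := mul_nonneg hαNle hMDL
  have hB2 : 0 ≤ 2 * (BV L + BD L) := by positivity
  have hVD := fun (A : PBond (i.1.1.P i.1.2.2) 0 → Matrix (Fin 2) (Fin 2) ℂ) =>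
    valueDiv_rows_GTone_of_letters (TJSlotP i.1.1 i.1.2.1 i.1.2.2 i.2.2.le (c₀ L) (cB L) a) U₀ hregN ha hp₀ hp₁
      (hBV L hL) (hBD L hL) (hC₁ L hL) (hC₂ L hL) (hC₃ L hL) hCT0 hCTD0 hV hDiv hc1 hc2m hc3 hTJ hTJd hwin A (s := ‖A‖) (fun b => norm_le_pi_norm A b)
  have hV1 := fun (A : PBond (i.1.1.P i.1.2.2) 0 → Matrix (Fin 2) (Fin 2) ℂ) => (hVD A).1
  have hD1 := fun (A : PBond (i.1.1.P i.1.2.2) 0 → Matrix (Fin 2) (Fin 2) ℂ) => (hVD A).2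
  rw [DeltaOnePJ_def]
  exact norm_frakGfR_le_of_letters (TJSlotP i.1.1 i.1.2.1 i.1.2.2 i.2.2.le (c₀ L) (cB L) a) U₀ hregN ha hp₀ hp₁
    hB2 hB2 (hC₂ L hL) (hBHq L hL) (by norm_num) hV1 hD1 hc1 hc2m hc3 hTJ hTJd hQ hG0m hHDm h3m hHm f

end Summit.QuantumFields.YangMills.Theorems.Prop7NormGFamilyPackage

end
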